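import Literature.NumberTheory.PAdicHodge.AinfWeierstrassTateModuleMatching
import Literature.NumberTheory.GaloisRepresentations.LubinTateTorsion
import HarnessLib

/-!
# `T_pŴ(𝒪_{ℂ_F})` for a Weierstrass equation with coefficients in `𝒪_F` (the good model over a RAMIFIED base), and its matching with
# `T_p E(ℂ_F)`

Topic `Literature/NumberTheory/PAdicHodge`. The object half of brick (R1) of
`Summits/…/Cruxes/StarredOptimalManinUnitFiveSeven/Lines/kato-lever-hDR-sector-iii-periods.md` §5 for the matching lane (M): K★'s additive cells
acquire good (supersingular) reduction only over a ramified `F`, where the good model `W'` has coefficients in `𝒪_F`, not `ℤ`. Here, for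
`W : WeierstrassCurve (LTCoeff F)` (`LTCoeff F` = the tree's DISCRETE copy of `𝒪[F]`):

* `coeffToCBall' : LTCoeff F →+* 𝒪_{ℂ_F}`, `Algebra (LTCoeff F) (CBall F)`, `ContinuousSMul` — so the whole NilIdeal dictionary
  (`WeierstrassFormalGroupPoints`, `FormalGroupNilIdealPoints*`, `SupersingularTateModuleFormalGroup`) applies to `W` over `ℂ_F`;
* `galCBallCoeffAlgHom σ : CBall F →ₐ[LTCoeff F] CBall F` (`σ ∈ Γ_F` fixes `F`), the action of `Γ_F` on `Ŵ(𝔪_{ℂ_F}) = W.Pt (maxNilIdealC F)`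
  by group automorphisms (`instDistribMulActionPtO`), **`TatePtO F p W := TateModule (W.Pt (maxNilIdealC F)) p`** with `tatePtORep`;
* **`tateModuleCEquivTatePtO : T_p E(ℂ_F) ≃ₗ[ℤ_p] TatePtO F p W`** under `E[p^∞](ℂ_F) ⊂ E₁(ℂ_F)` and its `Γ_F`-equivariance
  (`tateModuleCEquivTatePtO_galois`), exactly as for `W/ℤ` (`AinfWeierstrassTateModuleMatching`).

What is NOT here: the period maps for `𝒪_F`-coefficients (they need `A_inf,F = 𝒪_F ⊗ A_inf` or the Banach route: R1 proper), the discharge of the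
hypothesis for the good model (`SupersingularTateModuleFormalGroup.mem_kernel_of_pow_prime_smul_eq_zero` with the residue field of `𝒪_F`), the
geometric side `T_p E(F̄)`. BSD / K★: infrastructure; nothing about elliptic curves over number fields is proved here.

## References
* J. H. Silverman, *The Arithmetic of Elliptic Curves* (2009), III.§7, VII.2.2. [SilvermanAEC2009]
* J. Tate, *p-divisible groups* (1967), §4. [Tate1967]
-/

noncomputable section

open scoped Classical NNReal
open Field ValuativeRel

namespace Literature.NumberTheory.PAdicHodge

open Literature.NumberTheory.GaloisRepresentations
open Literature.NumberTheory.GaloisRepresentations.IsNonarchimedeanLocalField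
open Literature.NumberTheory.GaloisRepresentations.LubinTate
open Literature.NumberTheory.EllipticCurves Literature.NumberTheory.EllipticCurves.FormalGroupChart

namespace AinfTop

variable {F : Type} [Field F] [ValuativeRel F] [TopologicalSpace F] [IsNonarchimedeanLocalField F]

/-! ## §1 `𝒪_{ℂ_F}` as an algebra over the discrete copy of `𝒪_F` -/

variable (F) in
/-- **`𝒪_F → 𝒪_{ℂ_F}`**, `x ↦ x` (norm `≤ 1`, tree `CompletedAlgClosure.norm_algebraMap`), on the discrete copy `LTCoeff F` of `𝒪[F]`.
[cite: SilvermanAEC2009, VII.§1] -/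
def coeffToCBall' : LTCoeff F →+* CBall F where
  toFun x := ⟨algebraMap F (CompletedAlgClosure F) ((LTCoeff.of F).symm x : 𝒪[F]), by
    rw [mem_unitBall_iff, CompletedAlgClosure.norm_algebraMap, norm_le_one_iff]
    exact ((LTCoeff.of F).symm x).2⟩
  map_one' := by ext; simp
  map_mul' x y := by ext; simp
  map_zero' := by ext; simp
  map_add' x y := by ext; simp

/-- `𝒪_{ℂ_F}` as an algebra over the discrete coefficient ring `LTCoeff F = 𝒪[F]`. [cite: SilvermanAEC2009, VII.§1] -/
instance algLTCoeffCBall : Algebra (LTCoeff F) (CBall F) := (coeffToCBall' F).toAlgebra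

/-- The discrete coefficient ring acts continuously on `𝒪_{ℂ_F}`. [cite: SilvermanAEC2009, VII.§1] -/
instance contSMulLTCoeffCBall : ContinuousSMul (LTCoeff F) (CBall F) := by
  refine ⟨continuous_prod_of_discrete_left.mpr fun a => ?_⟩
  change Continuous fun s : CBall F => (coeffToCBall' F a) * s
  exact continuous_const_mul _

/-- Unfolding the algebra map in `ℂ_F`. [cite: SilvermanAEC2009, VII.§1] -/
theorem coe_algebraMap_ltCoeff (x : LTCoeff F) :
    ((algebraMap (LTCoeff F) (CBall F) x : CBall F) : CompletedAlgClosure F) =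
      algebraMap F (CompletedAlgClosure F) ((LTCoeff.of F).symm x : 𝒪[F]) := rfl

/-- `σ ∈ Γ_F` fixes the coefficients: `σ(ι x) = ι x` for `x ∈ 𝒪_F`. [cite: SilvermanAEC2009, VII.§1] -/
theorem galCBall_algebraMap_ltCoeff (σ : absoluteGaloisGroup F) (x : LTCoeff F) :
    galCBall σ (algebraMap (LTCoeff F) (CBall F) x) = algebraMap (LTCoeff F) (CBall F) x := by
  apply Subtype.ext
  rw [coe_galCBall, coe_algebraMap_ltCoeff, CompletedAlgClosure.smul_algebraMap]

/-- **`σ ∈ Γ_F` as a continuous `𝒪_F`-algebra endomorphism of `𝒪_{ℂ_F}`.** [cite: SilvermanAEC2009, VII.§1] -/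
def galCBallCoeffAlgHom (σ : absoluteGaloisGroup F) : CBall F →ₐ[LTCoeff F] CBall F :=
  { galCBall σ with commutes' := galCBall_algebraMap_ltCoeff σ }

/-- Unfolding. [cite: SilvermanAEC2009, VII.§1] -/
@[simp] theorem galCBallCoeffAlgHom_apply (σ : absoluteGaloisGroup F) (x : CBall F) : galCBallCoeffAlgHom σ x = galCBall σ x := rfl

/-! ## §2 `Γ_F` on `Ŵ(𝔪_{ℂ_F})` and the Tate module, for `W` over `𝒪_F` -/

variable (W : WeierstrassCurve (LTCoeff F))

/-- **`σ : Ŵ(𝔪_{ℂ_F}) →+ Ŵ(𝔪_{ℂ_F})`** for `W` over `𝒪_F` (`σ` fixes the coefficients). [cite: SilvermanAEC2009, VII.§1] -/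
def galPtO (σ : absoluteGaloisGroup F) : W.Pt (maxNilIdealC F) →+ W.Pt (maxNilIdealC F) :=
  WeierstrassCurve.Pt.map W (maxNilIdealC F) (maxNilIdealC F) (galCBallCoeffAlgHom σ) (continuous_galCBall σ)
    fun _ hx => galCBall_mem hx

/-- The action `σ • P := σ(P)` of `Γ_F` on `Ŵ(𝔪_{ℂ_F})`, `W` over `𝒪_F`. [cite: SilvermanAEC2009, VII.§1] -/
instance instSMulPtO : SMul (absoluteGaloisGroup F) (W.Pt (maxNilIdealC F)) := ⟨fun σ P => galPtO W σ P⟩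

/-- **`Γ_F` acts on `Ŵ(𝔪_{ℂ_F})` by group automorphisms** (`W` over `𝒪_F`). [cite: SilvermanAEC2009, VII.§1] -/
instance instDistribMulActionPtO : DistribMulAction (absoluteGaloisGroup F) (W.Pt (maxNilIdealC F)) where
  one_smul P := WeierstrassCurve.Pt.ext (Subtype.ext (Subtype.ext (by
    change (1 : absoluteGaloisGroup F) • ((P.val : CBall F) : CompletedAlgClosure F) = _
    rw [one_smul])))
  mul_smul σ τ P := WeierstrassCurve.Pt.ext (Subtype.ext (Subtype.ext (by
    change (σ * τ) • ((P.val : CBall F) : CompletedAlgClosure F) = σ • τ • ((P.val : CBall F) : CompletedAlgClosure F)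
    rw [mul_smul])))
  smul_zero σ := (galPtO W σ).map_zero
  smul_add σ P Q := (galPtO W σ).map_add P Q

variable (F) {p : ℕ} in
/-- **`T_pŴ(𝒪_{ℂ_F})` for `W` over `𝒪_F`.** [cite: SilvermanAEC2009, III.§7] [cite: Tate1967, §4] -/
abbrev TatePtO (p : ℕ) : Type := TateModule (W.Pt (maxNilIdealC F)) p

variable {p : ℕ} [Fact p.Prime]

variable (F p) in
/-- The Galois representation `Γ_F → Aut_{ℤ_p} T_pŴ(𝒪_{ℂ_F})`, `W` over `𝒪_F`. [cite: Tate1967, §4] -/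
def tatePtORep : Representation ℤ_[p] (absoluteGaloisGroup F) (TatePtO F W p) :=
  tateRepresentation (absoluteGaloisGroup F) (W.Pt (maxNilIdealC F)) p

/-- Unfolding `tatePtORep`. [cite: Tate1967, §4] -/
@[simp] theorem tatePtORep_apply_apply (σ : absoluteGaloisGroup F) (τ : TatePtO F W p) : tatePtORep F W p σ τ = σ • τ := rfl

/-! ## §3 The matching with `T_p E(ℂ_F)` -/

/-- `σ ∈ Γ_F` fixes the coefficients read in `ℂ_F`. [cite: SilvermanAEC2009, III.§1] -/
theorem galRingHom_cK_ltCoeff (σ : absoluteGaloisGroup F) (a : LTCoeff F) :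
    CompletedAlgClosure.galRingHom σ (cK (CompletedAlgClosure F) a) = cK (CompletedAlgClosure F) a := by
  rw [cK, ← CompletedAlgClosure.smul_def, coe_algebraMap_ltCoeff, CompletedAlgClosure.smul_algebraMap]

/-- **The action of `σ ∈ Γ_F` on `E(ℂ_F)`**, `E = W ⊗ ℂ_F`, `W` over `𝒪_F`. [cite: SilvermanAEC2009, III.§1] -/
def galPointCO (σ : absoluteGaloisGroup F) :
    (curveOver (CompletedAlgClosure F) W).toAffine.Point →+ (curveOver (CompletedAlgClosure F) W).toAffine.Point :=
  galPointHom (CompletedAlgClosure.galRingHom σ) (galRingHom_cK_ltCoeff σ)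

variable [hE : (curveOver (CompletedAlgClosure F) W).IsElliptic]

variable (F p) in
/-- **`T_p E(ℂ_F) ≃ₗ[ℤ_p] T_pŴ(𝒪_{ℂ_F})` for the `𝒪_F`-model `W`** when every `p`-power torsion point of `E(ℂ_F)` lies in `E₁(ℂ_F)`.
[cite: SilvermanAEC2009, Prop. VII.2.2] -/
def tateModuleCEquivTatePtO
    (hss : ∀ (n : ℕ) (P : (curveOver (CompletedAlgClosure F) W).toAffine.Point), p ^ n • P = 0 →
      P ∈ kernel (NormedField.valuation (K := CompletedAlgClosure F)) (curveOver (CompletedAlgClosure F) W)) :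
    TateModule (curveOver (CompletedAlgClosure F) W).toAffine.Point p ≃ₗ[ℤ_[p]] TatePtO F W p :=
  tateModuleEquivPt W p hss

/-- **Γ_F-equivariance** of `tateModuleCEquivTatePtO`. [cite: SilvermanAEC2009, Prop. VII.2.2] [cite: Tate1967, §4] -/
theorem tateModuleCEquivTatePtO_galois
    (hss : ∀ (n : ℕ) (P : (curveOver (CompletedAlgClosure F) W).toAffine.Point), p ^ n • P = 0 →
      P ∈ kernel (NormedField.valuation (K := CompletedAlgClosure F)) (curveOver (CompletedAlgClosure F) W))
    (σ : absoluteGaloisGroup F) (τ : TateModule (curveOver (CompletedAlgClosure F) W).toAffine.Point p) :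
    tateModuleCEquivTatePtO F W p hss (TateModule.map p (galPointCO W σ) τ) = σ • tateModuleCEquivTatePtO F W p hss τ :=
  tateModuleToPt_map_galPointHom (CompletedAlgClosure.galRingHom σ) (galRingHom_cK_ltCoeff σ)
    (galCBallCoeffAlgHom σ) (continuous_galCBall σ) (fun _ hx => galCBall_mem hx) (fun _ => rfl) hss τ

end AinfTop

end Literature.NumberTheory.PAdicHodge

end
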